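import Literature.NumberTheory.LFunctions.GranvilleMollinLinnikReduction
import Literature.NumberTheory.LFunctions.LogFreeDensityLocal
import Literature.NumberTheory.Sieve.MontgomeryVaughan1975Lemma43Tools
import HarnessLib

/-!
# Granville–Mollin (3.2)–(3.3) from the log-free zero-density estimate (Bombieri, p. 55)

Topic `Literature/NumberTheory/LFunctions`. THEOREMS (everything here is proved; no named fact is
introduced). This file reduces the one remaining analytic input of Granville–Mollin's explicit
formula in the Linnik range,

* `Literature.NumberTheory.LFunctions.GranvilleMollin2000_eq32` — Granville–Mollin (3.2), the sum
  `∑' x^{Re ρ} ≪ x^{1/2}T³ + δ x^{1−c/log T}` over the zeros of one real `L`-function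
  (`LinnikZeroSumBound.lean`; from it `Literature.NumberTheory.LFunctions.SiegelZero.GranvilleMollin2000_eq33`
  follows by `GranvilleMollin2000_eq33_of_eq32`, `GranvilleMollinLinnikReduction.lean`) —

to the statement it is made of in print: Bombieri's computation (*Le grand crible*, "Preuve du
Théorème de Linnik", p. 55) of the Linnik sum `∑∑∑' |x^ρ| = −∫ x^α dN(α) ≪ x^{1/2}(…) +
(δ₁ log T) x^{1−c₁/log T} log x/log(x/T^{c₂})` from his **Théorème 14** (the log-free zero-density
estimate `N(α, T; χ) ≪ T^{c₂(1−α)}`, and `≪ (δ₁ log T) T^{c₂(1−α)}` in the presence of an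
exceptional zero) and the Lemme de Landau–Page. Concretely:

* `LinnikZeroSum.sum_mul_rpow_le_of_density` — the partial summation behind p. 55 for an abstract
  finite family (`βᵢ ≤ 1 − η`, `∑_{α ≤ βᵢ} wᵢ ≤ A B^{1−α}`): for every `x > B`,
  `∑ wᵢ x^{βᵢ−1} ≤ e A (B/x)^η log x/log(x/B)`. (The tree's
  `Literature.NumberTheory.Sieve.MontgomeryVaughan1975.sum_mul_rpow_sub_one_le_of_density`,
  Gallagher 1970 §5, is the range `x ≥ B²`; Granville–Mollin's "`x ≥ T^C`, `C > 9`" with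
  `B = T^{c₂}`, `c₂ = 8 + ε`, needs the full range, the factor `log x/log(x/B) ≤ C/(C − c₂)` being
  Bombieri's `1/log(x/T^{c₂})`.)
* `charZeroCount χ α T E` — `N(α, T; χ)` with an exclusion set (Bombieri's "zéro exceptionnel
  exclu"), `exists_boxCount_le` — `N(T, χ) ≪ T log T` for `q ≤ T` (MV Thm 10.17 summed over
  windows), `charZeroPowerSum_le_of_countT` — the power sum `∑_{ρ ∉ E} m(ρ) x^{Re ρ}`
  (`charZeroPowerSum`) from a density bound `N(α, T; χ, E) ≤ D T^{c₂(1−α)}` and a zero-free strip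
  of width `λ/log T`: `≤ x^{1/2} N(T, χ) + e^{1+c₂λ} (C/(C−c₂)) D x^{1−λ/log T}` for `x ≥ T^C`,
  `C > c₂`.
* `GranvilleMollin2000_eq32_of_logFreeDensity` — **(3.2) from Théorème 14 for one character**:
  if for every `c₂ > 9` the single-character log-free density estimate with the Deuring–Heilbronn
  factor holds (hypothesis spelled out in the statement: Bombieri's Théorème 14 restricted to one
  primitive quadratic `χ` mod `q ≤ T`, exceptional zero "relatif à `T, c₁`"), then
  `GranvilleMollin2000_eq32`; and `GranvilleMollin2000_eq33_of_logFreeDensity` — hence (3.3).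
  The zero-free input is the tree's MV Theorem 11.3 (`DirichletZFR.exists_zeroFree`,
  `DirichletZFR.exists_min_realZeros_le`), the multiplicity of a mildly exceptional real zero is
  bounded by Bombieri's Lemme de densité (`LogFreeDensity.exists_sum_near_le`).

## On the exponent (why the hypothesis asks for every `c₂ > 9`)

Granville–Mollin state (3.2) "for fixed `C > 9`" and refer to Bombieri pp. 54–55, where
`x = T^A`, `A ≥ c₂ + 1`, and where `c₂` is the (absolute, effectively computable, but unspecified)
exponent of Théorème 14; "`c₂ = 8 + ε`" is Bombieri's Remarque after Théorème 14 (Selberg), printed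
for the first part of the theorem. Conversely a density exponent `≤ 9` is NECESSARY for (3.2) as
stated: `N'` zeros with `Re ρ ≥ 1 − λ/log T` contribute at least `N' x e^{−Aλ}` (`x = T^A`), so (3.2)
at `A = C` forces `N'(1 − λ/log T, T; χ) ≪_C δ e^{Cλ} + T^{3−C/2} e^{Cλ}`, i.e. a log-free density
bound with exponent `C` near `σ = 1`, for every `C > 9`. The computation below works for any
`C > c₂ ≥ 0` (`charZeroPowerSum_le_of_countT`), so a Théorème 14 with exponent `c₂` yields (3.2) for
all `C > c₂`.

## References

* E. Bombieri, *Le grand crible dans la théorie analytique des nombres*, Astérisque 18 (2ᵉ éd.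
  1987), §6: Lemme de Landau–Page (p. 39), Théorème 14 and Remarque (p. 40), Lemme de densité
  (p. 42), Preuve du Théorème de Linnik (pp. 54–55). [Bombieri1987GrandCrible]
* A. Granville, R. A. Mollin, *Rabinowitsch revisited*, Acta Arith. 96 (2000) 139–153, §3
  (3.1)–(3.3). [GranvilleMollin2000]
* P. X. Gallagher, *A large sieve density estimate near `σ = 1`*, Invent. Math. 11 (1970), §5.
  [Gallagher1970]
* H. L. Montgomery, R. C. Vaughan, *Multiplicative Number Theory I*, CUP 2007, Theorems 10.17,
  11.3. [MontgomeryVaughan2007]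
-/

noncomputable section

open Finset Real Complex

namespace Literature.NumberTheory.LFunctions

namespace LinnikZeroSum

open Literature.NumberTheory.Sieve.MontgomeryVaughan1975 (sum_pow_le_of_lt_one)

/-- `e/(e^θ − 1) ≤ e/θ` for `θ > 0`, in the form `e^{1−θ}/(1 − e^{−θ}) ≤ e/θ`. [folklore] -/
theorem exp_one_sub_div_le {θ : ℝ} (hθ : 0 < θ) :
    Real.exp (1 - θ) / (1 - Real.exp (-θ)) ≤ Real.exp 1 / θ := by
  have hden : 0 < 1 - Real.exp (-θ) := by
    rw [sub_pos, Real.exp_lt_one_iff]; linarith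
  have hexpθ : θ + 1 ≤ Real.exp θ := by linarith [Real.add_one_le_exp θ]
  rw [div_le_div_iff₀ hden hθ]
  have h1 : Real.exp (1 - θ) * θ = Real.exp 1 * (Real.exp (-θ) * θ) := by
    rw [show (1 : ℝ) - θ = 1 + -θ by ring, Real.exp_add]; ring
  rw [h1]
  refine mul_le_mul_of_nonneg_left ?_ (Real.exp_pos 1).le
  -- `θ e^{−θ} ≤ 1 − e^{−θ}` iff `θ + 1 ≤ e^{θ}`
  have hpos : 0 < Real.exp (-θ) := Real.exp_pos _
  have hmul : Real.exp (-θ) * Real.exp θ = 1 := by rw [← Real.exp_add]; simp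
  nlinarith [mul_le_mul_of_nonneg_left hexpθ hpos.le]

/-- **The sum over zeros against a log-free density bound, full range `x > B`** (Bombieri,
*Le grand crible*, p. 55; Gallagher 1970, §5): let `βᵢ ≤ 1 − η` (`i ∈ s`, finite) with weights
`wᵢ ≥ 0` and the density bound `∑_{i : α ≤ βᵢ} wᵢ ≤ A B^{1−α}` for every `α ≤ 1 − η` (`A ≥ 0`,
`B ≥ 1`). Then for every `x > B`,
`∑ᵢ wᵢ x^{βᵢ−1} ≤ e · A · (B/x)^η · (log x / log(x/B))`.
(The tree's `sum_mul_rpow_sub_one_le_of_density` is the case `x ≥ B²`, where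
`log x/log(x/B) ≤ 2`; Bombieri's range `x > T^{c₂}` with the factor `1/log(x/T^{c₂})` is this
one. Proof: slice `i` by `k = ⌊(1 − η − βᵢ) log x⌋`; the `k`-th slice has weight
`≤ A B^{η+(k+1)/log x}` and terms `≤ x^{−η}e^{−k}`, and `∑_k (B^{1/log x}/e)^k = 1/(1 − e^{−θ})`,
`θ = log(x/B)/log x`.) [cite: Bombieri1987GrandCrible, §6 Preuve du Théorème de Linnik, p. 55] -/
theorem sum_mul_rpow_le_of_density {ι : Type*} (s : Finset ι) (β w : ι → ℝ)
    {x B A η : ℝ} (hB : 1 ≤ B) (hBx : B < x) (hA : 0 ≤ A)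
    (hw : ∀ i ∈ s, 0 ≤ w i) (hβ : ∀ i ∈ s, β i ≤ 1 - η)
    (hdens : ∀ α : ℝ, α ≤ 1 - η → ∑ i ∈ s with α ≤ β i, w i ≤ A * B ^ (1 - α)) :
    ∑ i ∈ s, w i * x ^ (β i - 1) ≤
      Real.exp 1 * A * (B / x) ^ η * (Real.log x / Real.log (x / B)) := by
  classical
  have hx : 1 < x := lt_of_le_of_lt hB hBx
  have hx0 : 0 < x := by linarith
  have hB0 : 0 < B := by linarith
  set L : ℝ := Real.log x with hL
  have hL0 : 0 < L := Real.log_pos hx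
  set LB : ℝ := Real.log B with hLB
  have hLB0 : 0 ≤ LB := Real.log_nonneg hB
  have hLBL : LB < L := Real.log_lt_log hB0 hBx
  set θ : ℝ := Real.log (x / B) / L with hθ
  have hlogxB : Real.log (x / B) = L - LB := by rw [Real.log_div hx0.ne' hB0.ne']
  have hθ0 : 0 < θ := by rw [hθ, hlogxB]; exact div_pos (by linarith) hL0
  have hθ1 : θ ≤ 1 := by
    rw [hθ, hlogxB, div_le_one hL0]; linarith
  -- the slice index `k i = ⌊(1 − η − βᵢ) L⌋`
  set k : ι → ℕ := fun i => ⌊(1 - η - β i) * L⌋₊ with hk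
  have hkle : ∀ i ∈ s, (k i : ℝ) ≤ (1 - η - β i) * L := fun i hi =>
    Nat.floor_le (mul_nonneg (by linarith [hβ i hi]) hL0.le)
  have hklt : ∀ i, (1 - η - β i) * L < k i + 1 := fun i => Nat.lt_floor_add_one _
  have hterm : ∀ i ∈ s, x ^ (β i - 1) ≤ x ^ (-η) * Real.exp (-(k i : ℝ)) := by
    intro i hi
    have h1 : β i - 1 ≤ -η - k i / L := by
      have := hkle i hi
      have h2 : (k i : ℝ) / L ≤ 1 - η - β i := by rwa [div_le_iff₀ hL0]
      linarith
    calc x ^ (β i - 1) ≤ x ^ (-η - k i / L) := Real.rpow_le_rpow_of_exponent_le hx.le h1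
      _ = x ^ (-η) * x ^ (-(k i / L)) := by rw [sub_eq_add_neg, Real.rpow_add hx0]
      _ = x ^ (-η) * Real.exp (-(k i : ℝ)) := by
          congr 1
          rw [Real.rpow_def_of_pos hx0, ← hL]
          congr 1
          field_simp
  -- the weight of the `j`-th slice
  have hslice : ∀ j : ℕ, ∑ i ∈ s with k i = j, w i ≤ A * B ^ (η + ((j : ℝ) + 1) / L) := by
    intro j
    have hsub : (s.filter fun i => k i = j) ⊆ s.filter fun i => 1 - η - ((j : ℝ) + 1) / L ≤ β i := by
      intro i hi
      rw [Finset.mem_filter] at hi ⊢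
      refine ⟨hi.1, ?_⟩
      have h1 := hklt i
      rw [hi.2] at h1
      have h2 : 1 - η - β i < ((j : ℝ) + 1) / L := by rw [lt_div_iff₀ hL0]; exact h1
      linarith
    have hα : 1 - η - ((j : ℝ) + 1) / L ≤ 1 - η := by
      have : 0 ≤ ((j : ℝ) + 1) / L := by positivity
      linarith
    calc ∑ i ∈ s with k i = j, w i
        ≤ ∑ i ∈ s with 1 - η - ((j : ℝ) + 1) / L ≤ β i, w i :=
          Finset.sum_le_sum_of_subset_of_nonneg hsub fun i hi _ => hw i (Finset.mem_filter.1 hi).1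
      _ ≤ A * B ^ (1 - (1 - η - ((j : ℝ) + 1) / L)) := hdens _ hα
      _ = A * B ^ (η + ((j : ℝ) + 1) / L) := by ring_nf
  -- `b = B^{1/L} = e^{LB/L}`, ratio `r = b/e = e^{−θ} < 1`
  set b : ℝ := B ^ (1 / L) with hb
  have hb0 : 0 < b := Real.rpow_pos_of_pos hB0 _
  have hbexp : b = Real.exp (LB / L) := by
    rw [hb, Real.rpow_def_of_pos hB0, ← hLB]; congr 1; field_simp
  set r : ℝ := b * Real.exp (-1) with hr
  have hrexp : r = Real.exp (-θ) := by
    rw [hr, hbexp, ← Real.exp_add, hθ, hlogxB]; congr 1; field_simp; ring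
  have hr0 : 0 ≤ r := by positivity
  have hr1 : r < 1 := by rw [hrexp, Real.exp_lt_one_iff]; linarith
  have hpow : ∀ j : ℕ, B ^ (η + ((j : ℝ) + 1) / L) * Real.exp (-(j : ℝ)) = B ^ η * b * r ^ j := by
    intro j
    rw [Real.rpow_add hB0, show ((j : ℝ) + 1) / L = (1 / L) * ((j : ℝ) + 1) by ring,
      Real.rpow_mul hB0.le, ← hb, hr, mul_pow, ← Real.exp_nat_mul, Real.rpow_add_one hb0.ne',
      Real.rpow_natCast]
    ring_nf
  -- sum slice by slice
  set t : Finset ℕ := s.image k with ht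
  have hmaps : ∀ i ∈ s, k i ∈ t := fun i hi => Finset.mem_image_of_mem k hi
  have hgeom : b * (1 / (1 - r)) ≤ Real.exp 1 / θ := by
    have h1 : b * (1 / (1 - r)) = Real.exp (1 - θ) / (1 - Real.exp (-θ)) := by
      rw [← hrexp]
      have : b = Real.exp (1 - θ) := by
        rw [hbexp, hθ, hlogxB]; congr 1; field_simp; ring
      rw [this]; ring
    rw [h1]
    exact exp_one_sub_div_le hθ0
  calc ∑ i ∈ s, w i * x ^ (β i - 1)
      = ∑ j ∈ t, ∑ i ∈ s with k i = j, w i * x ^ (β i - 1) :=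
        (Finset.sum_fiberwise_of_maps_to hmaps _).symm
    _ ≤ ∑ j ∈ t, ∑ i ∈ s with k i = j, w i * (x ^ (-η) * Real.exp (-(j : ℝ))) := by
        refine Finset.sum_le_sum fun j _ => Finset.sum_le_sum fun i hi => ?_
        rw [Finset.mem_filter] at hi
        have h := hterm i hi.1
        rw [hi.2] at h
        exact mul_le_mul_of_nonneg_left h (hw i hi.1)
    _ = ∑ j ∈ t, (∑ i ∈ s with k i = j, w i) * (x ^ (-η) * Real.exp (-(j : ℝ))) := by
        refine Finset.sum_congr rfl fun j _ => ?_
        rw [Finset.sum_mul]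
    _ ≤ ∑ j ∈ t, A * B ^ (η + ((j : ℝ) + 1) / L) * (x ^ (-η) * Real.exp (-(j : ℝ))) := by
        refine Finset.sum_le_sum fun j _ => ?_
        exact mul_le_mul_of_nonneg_right (hslice j) (by positivity)
    _ = A * (B ^ η * x ^ (-η)) * b * ∑ j ∈ t, r ^ j := by
        rw [Finset.mul_sum]
        refine Finset.sum_congr rfl fun j _ => ?_
        have := hpow j
        calc A * B ^ (η + ((j : ℝ) + 1) / L) * (x ^ (-η) * Real.exp (-(j : ℝ)))
            = A * x ^ (-η) * (B ^ (η + ((j : ℝ) + 1) / L) * Real.exp (-(j : ℝ))) := by ring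
          _ = A * x ^ (-η) * (B ^ η * b * r ^ j) := by rw [this]
          _ = A * (B ^ η * x ^ (-η)) * b * r ^ j := by ring
    _ ≤ A * (B ^ η * x ^ (-η)) * b * (1 / (1 - r)) := by
        apply mul_le_mul_of_nonneg_left (sum_pow_le_of_lt_one t hr0 hr1)
        positivity
    _ = A * (B ^ η * x ^ (-η)) * (b * (1 / (1 - r))) := by ring
    _ ≤ A * (B ^ η * x ^ (-η)) * (Real.exp 1 / θ) :=
        mul_le_mul_of_nonneg_left hgeom (by positivity)
    _ = Real.exp 1 * A * (B / x) ^ η * (Real.log x / Real.log (x / B)) := by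
        rw [Real.div_rpow hB0.le hx0.le, Real.rpow_neg hx0.le, div_eq_mul_inv (B ^ η), hθ,
          ← hL]
        have hlog0 : Real.log (x / B) ≠ 0 := by rw [hlogxB]; exact (sub_pos.2 hLBL).ne'
        field_simp

/-- **The same with the density bound on `[1/2, 1 − η]` only**, for abscissae `βᵢ ≥ 1/2`
(for `α < 1/2` the count is the count at `α = 1/2` and `B^{1−α} ≥ B^{1/2}`). [folklore] -/
theorem sum_mul_rpow_le_of_density_half {ι : Type*} (s : Finset ι) (β w : ι → ℝ)
    {x B A η : ℝ} (hB : 1 ≤ B) (hBx : B < x) (hA : 0 ≤ A) (hη : η ≤ 1 / 2)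
    (hw : ∀ i ∈ s, 0 ≤ w i) (hhalf : ∀ i ∈ s, 1 / 2 ≤ β i) (hβ : ∀ i ∈ s, β i ≤ 1 - η)
    (hdens : ∀ α : ℝ, 1 / 2 ≤ α → α ≤ 1 - η → ∑ i ∈ s with α ≤ β i, w i ≤ A * B ^ (1 - α)) :
    ∑ i ∈ s, w i * x ^ (β i - 1) ≤
      Real.exp 1 * A * (B / x) ^ η * (Real.log x / Real.log (x / B)) := by
  refine sum_mul_rpow_le_of_density s β w hB hBx hA hw hβ fun α hα => ?_
  rcases le_or_gt (1 / 2) α with h0 | hlt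
  · exact hdens α h0 hα
  · have h0 := hdens (1 / 2) le_rfl (by linarith)
    have hfilter : (s.filter fun i => α ≤ β i) = s.filter fun i => (1 / 2 : ℝ) ≤ β i := by
      ext i
      simp only [Finset.mem_filter]
      constructor
      · rintro ⟨hi, -⟩; exact ⟨hi, hhalf i hi⟩
      · rintro ⟨hi, -⟩; exact ⟨hi, by linarith [hhalf i hi]⟩
    rw [hfilter]
    refine h0.trans (mul_le_mul_of_nonneg_left ?_ hA)
    exact Real.rpow_le_rpow_of_exponent_le hB (by linarith)

end LinnikZeroSum

/-! ## The zero-counting function `N(α, T; χ)` with an exclusion set -/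

section Count

variable {q : ℕ} [NeZero q] (χ : DirichletCharacter ℂ q)

/-- `N(α, T; χ, E) = ∑_{ρ ∈ box(T) ∖ E, Re ρ ≥ α} m(ρ)`: the number of non-trivial zeros
`ρ = β + iγ` of `L(s, χ)` with `α ≤ β < 1`, `|γ| ≤ T`, outside the finite exclusion set `E` (the
exceptional zero, when it is to be omitted), counted with multiplicity
`m(ρ) = Literature.NumberTheory.LFunctions.DirichletDisc.zeroOrder χ ρ`; a `Finset` sum over
`lfunctionZeroBox χ T` when this set is finite (always, for `χ ≠ χ₀`), and `0` otherwise. This is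
Bombieri's `N(α, T; χ)` ("zéro exceptionnel exclu") for one character.
[cite: Bombieri1987GrandCrible, §6 Théorème 14] -/
def charZeroCount (α T : ℝ) (E : Finset ℂ) : ℝ := by
  classical
  exact if h : (lfunctionZeroBox χ T).Finite then
    ∑ ρ ∈ (h.toFinset \ E).filter (fun ρ => α ≤ ρ.re), (DirichletDisc.zeroOrder χ ρ : ℝ) else 0

variable {χ}

/-- For `χ ≠ χ₀`, `charZeroCount` is the `Finset` sum over the finite box. [folklore] -/
theorem charZeroCount_eq (hχ : χ ≠ 1) (α T : ℝ) (E : Finset ℂ) :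
    charZeroCount χ α T E =
      ∑ ρ ∈ ((lfunctionZeroBox_finite hχ T).toFinset \ E).filter (fun ρ => α ≤ ρ.re),
        (DirichletDisc.zeroOrder χ ρ : ℝ) := by
  classical
  rw [charZeroCount, dif_pos (lfunctionZeroBox_finite hχ T)]

/-- Enlarging the exclusion set can only decrease the count. [folklore] -/
theorem charZeroCount_mono (hχ : χ ≠ 1) (α T : ℝ) {E E' : Finset ℂ} (h : E ⊆ E') :
    charZeroCount χ α T E' ≤ charZeroCount χ α T E := by
  classical
  rw [charZeroCount_eq hχ, charZeroCount_eq hχ]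
  refine Finset.sum_le_sum_of_subset_of_nonneg ?_ fun _ _ _ => Nat.cast_nonneg _
  intro ρ hρ
  rw [Finset.mem_filter, Finset.mem_sdiff] at hρ ⊢
  exact ⟨⟨hρ.1.1, fun h' => hρ.1.2 (h h')⟩, hρ.2⟩

/-- The count is at most the total multiplicity of the box. [folklore] -/
theorem charZeroCount_le_sum (hχ : χ ≠ 1) (α T : ℝ) (E : Finset ℂ) :
    charZeroCount χ α T E ≤
      ∑ ρ ∈ (lfunctionZeroBox_finite hχ T).toFinset, (DirichletDisc.zeroOrder χ ρ : ℝ) := by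
  classical
  rw [charZeroCount_eq hχ]
  refine Finset.sum_le_sum_of_subset_of_nonneg ?_ fun _ _ _ => Nat.cast_nonneg _
  intro ρ hρ
  rw [Finset.mem_filter, Finset.mem_sdiff] at hρ
  exact hρ.1.1

/-- Removing one point `b` from the power sum costs at most its own term `m(b) x^{Re b}`
(`x ≥ 0`). [folklore] -/
theorem charZeroPowerSum_empty_le (hχ : χ ≠ 1) {x : ℝ} (hx : 0 ≤ x) (T : ℝ) (b : ℂ) :
    charZeroPowerSum χ x T ∅ ≤
      charZeroPowerSum χ x T {b} + (DirichletDisc.zeroOrder χ b : ℝ) * x ^ b.re := by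
  classical
  rw [charZeroPowerSum_eq hχ, charZeroPowerSum_eq hχ, Finset.sdiff_empty]
  set F := (lfunctionZeroBox_finite hχ T).toFinset with hF
  by_cases hb : b ∈ F
  · rw [← Finset.sum_sdiff (Finset.singleton_subset_iff.2 hb), Finset.sum_singleton]
  · have : F \ {b} = F := by
      rw [Finset.sdiff_eq_self_iff_disjoint, Finset.disjoint_singleton_right]; exact hb
    rw [this]
    have h0 : 0 ≤ (DirichletDisc.zeroOrder χ b : ℝ) * x ^ b.re :=
      mul_nonneg (Nat.cast_nonneg _) (Real.rpow_nonneg hx _)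
    linarith

end Count

/-! ## The total multiplicity of the box `|γ| ≤ T` -/

/-- **`N(T, χ) ≪ T log qT`, crude form**: there is an absolute `C₀` such that for every primitive
`χ` mod `q > 1`, every `T ≥ 6` with `q ≤ T` and every finite set `P` of non-trivial zeros with
`|Im ρ| ≤ T`, `∑_{ρ ∈ P} m(ρ) ≤ C₀ T log T` (the window bound
`ExplicitPsiChar.exists_sum_window_le`, MV Thm. 10.17, summed over the `≤ 2T + 3` unit windows
centred at the integers `|j| ≤ ⌊T⌋ + 1`, each `≤ C(log q + log(|j| + 4)) ≤ 3C log T`).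
[cite: MontgomeryVaughan2007, Theorem 10.17] -/
theorem exists_boxCount_le :
    ∃ C₀ : ℝ, 0 < C₀ ∧ ∀ (q : ℕ) [NeZero q] (χ : DirichletCharacter ℂ q), χ.IsPrimitive → 1 < q →
      ∀ T : ℝ, 6 ≤ T → (q : ℝ) ≤ T → ∀ P : Finset ℂ, (∀ ρ ∈ P, ρ ∈ lfunctionZeroBox χ T) →
        ∑ ρ ∈ P, (DirichletDisc.zeroOrder χ ρ : ℝ) ≤ C₀ * T * Real.log T := by
  obtain ⟨C, hC0, hC⟩ := ExplicitPsiChar.exists_sum_window_le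
  refine ⟨9 * C, by positivity, fun q _ χ hprim hq T hT hqT P hP => ?_⟩
  classical
  have hT0 : 0 < T := by linarith
  have hlogT : Real.log 2 ≤ Real.log T := Real.log_le_log (by norm_num) (by linarith)
  have hlog2 : 0 < Real.log 2 := Real.log_pos (by norm_num)
  have hlogT0 : 0 < Real.log T := by linarith
  set N : ℕ := ⌊T⌋₊ + 1 with hN
  have hNT : (N : ℝ) ≤ T + 1 := by
    rw [hN]; push_cast; linarith [Nat.floor_le hT0.le]
  have hTN : T < N := by rw [hN]; push_cast; exact Nat.lt_floor_add_one T
  set j : ℂ → ℤ := fun ρ => ⌊ρ.im + 1 / 2⌋ with hj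
  set t : Finset ℤ := Finset.Icc (-(N : ℤ)) N with ht
  have hmaps : ∀ ρ ∈ P, j ρ ∈ t := by
    intro ρ hρ
    obtain ⟨-, -, -, him⟩ := (mem_lfunctionZeroBox).1 (hP ρ hρ)
    rw [abs_le] at him
    rw [ht, Finset.mem_Icc, hj]
    constructor
    · rw [Int.le_floor]; push_cast; linarith
    · rw [Int.floor_le_iff]; push_cast; linarith
  rw [← Finset.sum_fiberwise_of_maps_to hmaps]
  -- each window
  have hwin : ∀ i ∈ t, ∑ ρ ∈ P with j ρ = i, (DirichletDisc.zeroOrder χ ρ : ℝ) ≤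
      3 * C * Real.log T := by
    intro i hi
    rw [ht, Finset.mem_Icc] at hi
    have hiabs : |(i : ℝ)| ≤ T + 1 := by
      rw [abs_le]
      have h1 : (-(N : ℤ) : ℝ) ≤ (i : ℝ) := by exact_mod_cast hi.1
      have h2 : ((i : ℤ) : ℝ) ≤ (N : ℝ) := by exact_mod_cast hi.2
      push_cast at h1
      constructor <;> linarith
    have h := hC q χ hprim hq (i : ℝ) (P.filter fun ρ => j ρ = i) (by
      intro ρ hρ
      rw [Finset.mem_filter] at hρ
      obtain ⟨h0, h1, h2, -⟩ := (mem_lfunctionZeroBox).1 (hP ρ hρ.1)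
      refine ⟨h0, h1, h2, ?_⟩
      have hfl : (i : ℝ) ≤ ρ.im + 1 / 2 ∧ ρ.im + 1 / 2 < i + 1 := by
        have := hρ.2
        rw [hj] at this
        dsimp only at this
        rw [← this]
        exact ⟨Int.floor_le _, Int.lt_floor_add_one _⟩
      rw [abs_le]
      constructor <;> linarith [hfl.1, hfl.2])
    refine h.trans ?_
    have hq1 : (1 : ℝ) < q := by exact_mod_cast hq
    have hlq : Real.log q ≤ Real.log T := Real.log_le_log (by linarith) hqT
    have hli : Real.log (|(i : ℝ)| + 4) ≤ 2 * Real.log T := by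
      have h1 : |(i : ℝ)| + 4 ≤ T * T := by nlinarith
      calc Real.log (|(i : ℝ)| + 4) ≤ Real.log (T * T) :=
            Real.log_le_log (by positivity) h1
        _ = 2 * Real.log T := by rw [Real.log_mul hT0.ne' hT0.ne']; ring
    nlinarith
  calc ∑ i ∈ t, ∑ ρ ∈ P with j ρ = i, (DirichletDisc.zeroOrder χ ρ : ℝ)
      ≤ ∑ i ∈ t, 3 * C * Real.log T := Finset.sum_le_sum hwin
    _ = (t.card : ℝ) * (3 * C * Real.log T) := by rw [Finset.sum_const, nsmul_eq_mul]
    _ ≤ (3 * T) * (3 * C * Real.log T) := by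
        refine mul_le_mul_of_nonneg_right ?_ (by positivity)
        have hcard : (t.card : ℝ) = 2 * N + 1 := by
          rw [ht, Int.card_Icc]
          have : ((N : ℤ) + 1 - -(N : ℤ)).toNat = 2 * N + 1 := by omega
          rw [this]; push_cast; ring
        rw [hcard]; linarith
    _ = 9 * C * T * Real.log T := by ring

/-! ## From a density bound to the power sum, for one character -/

section Core

variable {q : ℕ} [NeZero q] {χ : DirichletCharacter ℂ q}

/-- **The power sum from a density bound** (abstract thresholds): if every zero of the box outside
`E` has `Re ρ ≤ 1 − η` (`η ≤ 1/2`) and `N(α, T; χ, E) ≤ D B^{1−α}` for `1/2 ≤ α ≤ 1 − η`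
(`D ≥ 0`, `B ≥ 1`), then for `x > B`,
`∑_{ρ ∉ E} m(ρ) x^{Re ρ} ≤ x^{1/2} N + x · e D (B/x)^η log x/log(x/B)`, where `N` is any bound
for the total multiplicity of the box (the zeros with `Re ρ < 1/2` contribute `≤ x^{1/2}` each).
[cite: Bombieri1987GrandCrible, §6 Preuve du Théorème de Linnik, p. 55] -/
theorem charZeroPowerSum_le_of_count (hχ : χ ≠ 1) {x B D η T N : ℝ} (E : Finset ℂ)
    (hB : 1 ≤ B) (hBx : B < x) (hD : 0 ≤ D) (hη : η ≤ 1 / 2)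
    (hre : ∀ ρ ∈ lfunctionZeroBox χ T, ρ ∉ E → ρ.re ≤ 1 - η)
    (hdens : ∀ α : ℝ, 1 / 2 ≤ α → α ≤ 1 - η → charZeroCount χ α T E ≤ D * B ^ (1 - α))
    (hN : ∑ ρ ∈ (lfunctionZeroBox_finite hχ T).toFinset, (DirichletDisc.zeroOrder χ ρ : ℝ) ≤ N) :
    charZeroPowerSum χ x T E ≤
      x ^ (1 / 2 : ℝ) * N + x * (Real.exp 1 * D * (B / x) ^ η * (Real.log x / Real.log (x / B))) := by
  classical
  have hx1 : 1 < x := lt_of_le_of_lt hB hBx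
  have hx0 : 0 < x := by linarith
  set F := (lfunctionZeroBox_finite hχ T).toFinset \ E with hF
  have hmemF : ∀ ρ ∈ F, ρ ∈ lfunctionZeroBox χ T ∧ ρ ∉ E := by
    intro ρ hρ
    rw [hF, Finset.mem_sdiff, Set.Finite.mem_toFinset] at hρ
    exact hρ
  rw [charZeroPowerSum_eq hχ, ← hF]
  rw [← Finset.sum_filter_add_sum_filter_not F (fun ρ : ℂ => (1 / 2 : ℝ) ≤ ρ.re)]
  -- the right half: the density lemma
  set Fp := F.filter (fun ρ : ℂ => (1 / 2 : ℝ) ≤ ρ.re) with hFp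
  have hright : ∑ ρ ∈ Fp, (DirichletDisc.zeroOrder χ ρ : ℝ) * x ^ ρ.re ≤
      x * (Real.exp 1 * D * (B / x) ^ η * (Real.log x / Real.log (x / B))) := by
    have key := LinnikZeroSum.sum_mul_rpow_le_of_density_half Fp (fun ρ => ρ.re)
      (fun ρ => (DirichletDisc.zeroOrder χ ρ : ℝ)) hB hBx hD hη
      (fun _ _ => Nat.cast_nonneg _)
      (fun ρ hρ => (Finset.mem_filter.1 hρ).2)
      (fun ρ hρ => by
        obtain ⟨h1, h2⟩ := hmemF ρ (Finset.mem_filter.1 hρ).1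
        exact hre ρ h1 h2)
      (by
        intro α hα hαη
        have h := hdens α hα hαη
        rw [charZeroCount_eq hχ, ← hF] at h
        have hset : Fp.filter (fun ρ : ℂ => α ≤ ρ.re) = F.filter (fun ρ : ℂ => α ≤ ρ.re) := by
          ext ρ
          simp only [hFp, Finset.mem_filter]
          constructor
          · rintro ⟨⟨h1, -⟩, h3⟩; exact ⟨h1, h3⟩
          · rintro ⟨h1, h3⟩; exact ⟨⟨h1, hα.trans h3⟩, h3⟩
        rw [hset]; exact h)
    have hsum : ∑ ρ ∈ Fp, (DirichletDisc.zeroOrder χ ρ : ℝ) * x ^ ρ.re =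
        x * ∑ ρ ∈ Fp, (DirichletDisc.zeroOrder χ ρ : ℝ) * x ^ (ρ.re - 1) := by
      rw [Finset.mul_sum]
      refine Finset.sum_congr rfl fun ρ _ => ?_
      rw [Real.rpow_sub_one hx0.ne']
      field_simp
    rw [hsum]
    exact mul_le_mul_of_nonneg_left key hx0.le
  -- the left half: each term `≤ x^{1/2} m(ρ)`
  have hleft : ∑ ρ ∈ F.filter (fun ρ : ℂ => ¬ (1 / 2 : ℝ) ≤ ρ.re),
      (DirichletDisc.zeroOrder χ ρ : ℝ) * x ^ ρ.re ≤ x ^ (1 / 2 : ℝ) * N := by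
    calc ∑ ρ ∈ F.filter (fun ρ : ℂ => ¬ (1 / 2 : ℝ) ≤ ρ.re), (DirichletDisc.zeroOrder χ ρ : ℝ) * x ^ ρ.re
        ≤ ∑ ρ ∈ F.filter (fun ρ : ℂ => ¬ (1 / 2 : ℝ) ≤ ρ.re),
            (DirichletDisc.zeroOrder χ ρ : ℝ) * x ^ (1 / 2 : ℝ) := by
          refine Finset.sum_le_sum fun ρ hρ => ?_
          have hlt : ρ.re < 1 / 2 := not_le.1 (Finset.mem_filter.1 hρ).2
          exact mul_le_mul_of_nonneg_left
            (Real.rpow_le_rpow_of_exponent_le hx1.le hlt.le) (Nat.cast_nonneg _)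
      _ = x ^ (1 / 2 : ℝ) * ∑ ρ ∈ F.filter (fun ρ : ℂ => ¬ (1 / 2 : ℝ) ≤ ρ.re),
            (DirichletDisc.zeroOrder χ ρ : ℝ) := by rw [Finset.mul_sum]; refine Finset.sum_congr rfl fun _ _ => ?_; ring
      _ ≤ x ^ (1 / 2 : ℝ) * N := by
          refine mul_le_mul_of_nonneg_left (le_trans ?_ hN) (by positivity)
          refine Finset.sum_le_sum_of_subset_of_nonneg ?_ fun _ _ _ => Nat.cast_nonneg _
          intro ρ hρ
          have := (Finset.mem_filter.1 hρ).1
          rw [hF, Finset.mem_sdiff] at this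
          exact this.1
  linarith

/-- `log x / log(x/T^{c₂}) ≤ C/(C − c₂)` for `x ≥ T^C`, `0 ≤ c₂ < C`, `T > 1`. [folklore] -/
theorem log_div_log_le {x T C c₂ : ℝ} (hT : 1 < T) (hc₂ : 0 ≤ c₂) (hcC : c₂ < C)
    (hx : T ^ C ≤ x) : Real.log x / Real.log (x / T ^ c₂) ≤ C / (C - c₂) := by
  have hT0 : 0 < T := by linarith
  have hℓ : 0 < Real.log T := Real.log_pos hT
  have hTC : 0 < T ^ C := Real.rpow_pos_of_pos hT0 C
  have hx0 : 0 < x := lt_of_lt_of_le hTC hx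
  have hLx : C * Real.log T ≤ Real.log x := by
    rw [← Real.log_rpow hT0]; exact Real.log_le_log hTC hx
  have hlog : Real.log (x / T ^ c₂) = Real.log x - c₂ * Real.log T := by
    rw [Real.log_div hx0.ne' (Real.rpow_pos_of_pos hT0 c₂).ne', Real.log_rpow hT0]
  rw [hlog]
  have hden : 0 < Real.log x - c₂ * Real.log T := by nlinarith
  rw [div_le_div_iff₀ hden (by linarith)]
  nlinarith

/-- **The power sum from a density bound, Bombieri's thresholds**: with `B = T^{c₂}`,
`η = λ/log T`, `x ≥ T^C` (`C > c₂ ≥ 0`, `T > 1`, `0 < λ`, `λ ≤ (log T)/2`): if every zero of the box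
outside `E` has `Re ρ ≤ 1 − λ/log T` and `N(α, T; χ, E) ≤ D T^{c₂(1−α)}` for `1/2 ≤ α ≤ 1 − λ/log T`,
then `∑_{ρ ∉ E} m(ρ) x^{Re ρ} ≤ x^{1/2} N + e · e^{c₂λ} · (C/(C − c₂)) · D · x^{1 − λ/log T}`.
[cite: Bombieri1987GrandCrible, §6 Preuve du Théorème de Linnik, p. 55] -/
theorem charZeroPowerSum_le_of_countT (hχ : χ ≠ 1) {x T C c₂ D lam N : ℝ} (E : Finset ℂ)
    (hT : 1 < T) (hc₂ : 0 ≤ c₂) (hcC : c₂ < C) (hx : T ^ C ≤ x) (hD : 0 ≤ D) (hlam : 0 < lam)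
    (hlam2 : lam / Real.log T ≤ 1 / 2)
    (hre : ∀ ρ ∈ lfunctionZeroBox χ T, ρ ∉ E → ρ.re ≤ 1 - lam / Real.log T)
    (hdens : ∀ α : ℝ, 1 / 2 ≤ α → α ≤ 1 - lam / Real.log T →
      charZeroCount χ α T E ≤ D * T ^ (c₂ * (1 - α)))
    (hN : ∑ ρ ∈ (lfunctionZeroBox_finite hχ T).toFinset, (DirichletDisc.zeroOrder χ ρ : ℝ) ≤ N) :
    charZeroPowerSum χ x T E ≤
      x ^ (1 / 2 : ℝ) * N +
        Real.exp 1 * Real.exp (c₂ * lam) * (C / (C - c₂)) * D * x ^ (1 - lam / Real.log T) := by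
  have hT0 : 0 < T := by linarith
  have hℓ : 0 < Real.log T := Real.log_pos hT
  set B : ℝ := T ^ c₂ with hB
  have hB1 : 1 ≤ B := Real.one_le_rpow hT.le hc₂
  have hBx : B < x := by
    have : T ^ c₂ < T ^ C := Real.rpow_lt_rpow_of_exponent_lt hT hcC
    rw [hB]; linarith
  have hx0 : 0 < x := by linarith
  have key := charZeroPowerSum_le_of_count hχ E hB1 hBx hD hlam2 hre
    (fun α hα hαη => by
      have h := hdens α hα hαη
      rwa [hB, ← Real.rpow_mul hT0.le])
    hN
  refine key.trans (add_le_add le_rfl ?_)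
  -- `x · e D (B/x)^η · (log x/log(x/B)) ≤ e e^{c₂λ} (C/(C−c₂)) D x^{1−η}`
  have hratio : Real.log x / Real.log (x / B) ≤ C / (C - c₂) := log_div_log_le hT hc₂ hcC hx
  have hBxη : (B / x) ^ (lam / Real.log T) = Real.exp (c₂ * lam) * x ^ (-(lam / Real.log T)) := by
    rw [Real.div_rpow (by linarith) hx0.le, hB, ← Real.rpow_mul hT0.le, Real.rpow_neg hx0.le,
      div_eq_mul_inv]
    congr 1
    rw [Real.rpow_def_of_pos hT0]
    congr 1
    field_simp
  have hxpow : x * x ^ (-(lam / Real.log T)) = x ^ (1 - lam / Real.log T) := by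
    rw [sub_eq_add_neg, Real.rpow_add hx0, Real.rpow_one]
  have hratio0 : 0 ≤ Real.log x / Real.log (x / B) := by
    have hx1 : 1 < x := lt_of_le_of_lt hB1 hBx
    exact div_nonneg (Real.log_nonneg hx1.le) (Real.log_nonneg ((one_le_div (by linarith)).2 hBx.le))
  calc x * (Real.exp 1 * D * (B / x) ^ (lam / Real.log T) * (Real.log x / Real.log (x / B)))
      = (Real.exp 1 * Real.exp (c₂ * lam) * D * (x * x ^ (-(lam / Real.log T)))) *
          (Real.log x / Real.log (x / B)) := by rw [hBxη]; ring
    _ ≤ (Real.exp 1 * Real.exp (c₂ * lam) * D * (x * x ^ (-(lam / Real.log T)))) *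
          (C / (C - c₂)) := by
        refine mul_le_mul_of_nonneg_left hratio ?_
        rw [hxpow]; positivity
    _ = Real.exp 1 * Real.exp (c₂ * lam) * (C / (C - c₂)) * D * x ^ (1 - lam / Real.log T) := by
        rw [hxpow]; ring

end Core

/-! ## The classical inputs, packaged for the box `|γ| ≤ T`, `q ≤ T` -/

section Inputs

/-- **Complex zeros obey the classical zero-free region**, packaged: there is an absolute `c > 0`
such that for `χ ≠ χ₀` mod `q ≤ T`, `T ≥ 3`, every non-trivial zero `ρ` with `|Im ρ| ≤ T` and
`Im ρ ≠ 0` has `Re ρ ≤ 1 − c/(3 log T)` (MV Theorem 11.3: a zero with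
`Re ρ > 1 − c/(log q + log(|γ| + 4))` is real; and `log q + log(|γ| + 4) ≤ 3 log T`).
[cite: MontgomeryVaughan2007, Theorem 11.3] -/
theorem exists_re_le_of_im_ne_zero :
    ∃ c : ℝ, 0 < c ∧ ∀ (q : ℕ) [NeZero q] (χ : DirichletCharacter ℂ q), χ ≠ 1 →
      ∀ T : ℝ, 3 ≤ T → (q : ℝ) ≤ T → ∀ ρ ∈ lfunctionZeroBox χ T, ρ.im ≠ 0 →
        ρ.re ≤ 1 - c / (3 * Real.log T) := by
  obtain ⟨c, hc, hZ⟩ := DirichletZFR.exists_zeroFree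
  refine ⟨c, hc, fun q _ χ hχ T hT hqT ρ hρ him => ?_⟩
  obtain ⟨h0, -, -, habs⟩ := (mem_lfunctionZeroBox).1 hρ
  by_contra hcon
  push Not at hcon
  have hT0 : 0 < T := by linarith
  have hq1 : (1 : ℝ) ≤ q := by exact_mod_cast NeZero.one_le
  have hℒ : Real.log q + Real.log (|ρ.im| + 4) ≤ 3 * Real.log T := by
    have h1 : Real.log q ≤ Real.log T := Real.log_le_log (by linarith) hqT
    have h2 : Real.log (|ρ.im| + 4) ≤ 2 * Real.log T := by
      have : |ρ.im| + 4 ≤ T * T := by nlinarith [abs_nonneg ρ.im]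
      calc Real.log (|ρ.im| + 4) ≤ Real.log (T * T) := Real.log_le_log (by positivity) this
        _ = 2 * Real.log T := by rw [Real.log_mul hT0.ne' hT0.ne']; ring
    linarith
  have hℒ1 : 1 ≤ Real.log q + Real.log (|ρ.im| + 4) := DirichletZFR.one_le_ell q ρ.im
  have hregion : 1 - c / (Real.log q + Real.log (|ρ.im| + 4)) < ρ.re := by
    have : c / (3 * Real.log T) ≤ c / (Real.log q + Real.log (|ρ.im| + 4)) :=
      div_le_div_of_nonneg_left hc.le (by linarith) hℒ
    linarith
  exact him (hZ q χ hχ ρ h0 hregion).2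

/-- **At most one real zero near `1`** (Landau–Page; MV Theorem 11.3, Case 4), packaged with the
threshold `1 − c/log 2q`: there is an absolute `c > 0` such that for `χ ≠ χ₀` mod `q`, two real
zeros `β₀, β₁ > 1 − c/log(2q)` of `L(s, χ)` coincide.
[cite: MontgomeryVaughan2007, Theorem 11.3 (proof, Case 4)] -/
theorem exists_realZeros_unique :
    ∃ c : ℝ, 0 < c ∧ ∀ (q : ℕ) [NeZero q] (χ : DirichletCharacter ℂ q), χ ≠ 1 → ∀ β₀ β₁ : ℝ,
      χ.LFunction β₀ = 0 → χ.LFunction β₁ = 0 →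
        1 - c / Real.log (2 * q) < β₀ → 1 - c / Real.log (2 * q) < β₁ → β₀ = β₁ := by
  obtain ⟨c, hc, hL⟩ := DirichletZFR.exists_min_realZeros_le
  refine ⟨c / 2, by positivity, fun q _ χ hχ β₀ β₁ h₀ h₁ hβ₀ hβ₁ => ?_⟩
  by_contra hne
  have hmin := hL q χ hχ β₀ β₁ h₀ h₁ hne
  have hq1 : (1 : ℝ) ≤ q := by exact_mod_cast NeZero.one_le
  have hlogq : 0 ≤ Real.log q := Real.log_nonneg hq1
  have hlog4 : Real.log 4 = 2 * Real.log 2 := by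
    rw [show (4 : ℝ) = 2 ^ 2 by norm_num, Real.log_pow]; push_cast; ring
  have hlog2 : 0 < Real.log 2 := Real.log_pos (by norm_num)
  have hlog2q : Real.log (2 * q) = Real.log 2 + Real.log q :=
    Real.log_mul (by norm_num) (by positivity)
  have hpos : 0 < Real.log (2 * q) := by rw [hlog2q]; linarith
  have hpos' : 0 < Real.log q + Real.log 4 := by rw [hlog4]; linarith
  -- `(c/2)/log(2q) ≤ c/(log q + log 4)`
  have hcmp : c / 2 / Real.log (2 * q) ≤ c / (Real.log q + Real.log 4) := by
    rw [div_div, div_le_div_iff₀ (by positivity) hpos']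
    rw [hlog2q, hlog4]
    nlinarith
  have h1 : 1 - c / 2 / Real.log (2 * q) < min β₀ β₁ := lt_min hβ₀ hβ₁
  linarith

/-- **The multiplicity of a real zero near `1` is bounded** (Bombieri's Lemme de densité,
`LogFreeDensity.exists_sum_near_le`, applied to the single zero): there is an absolute `C` such
that for `χ ≠ χ₀` mod `q`, `0 < r ≤ 1/4` and a real zero `β ≥ 1 − r` of `L(s, χ)`,
`m(β) ≤ C (1 + r (log q + log 4))`. [cite: Bombieri1987GrandCrible, §6 Lemme de densité] -/
theorem exists_zeroOrder_real_le :
    ∃ C : ℝ, 0 < C ∧ ∀ (q : ℕ) [NeZero q] (χ : DirichletCharacter ℂ q), χ ≠ 1 → ∀ (β r : ℝ),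
      χ.LFunction β = 0 → 0 < r → r ≤ 1 / 4 → 1 - r ≤ β →
        (DirichletDisc.zeroOrder χ β : ℝ) ≤ C * (1 + r * (Real.log q + Real.log 4)) := by
  obtain ⟨C, hC, hnear⟩ := LogFreeDensity.exists_sum_near_le
  refine ⟨C, hC, fun q _ χ hχ β r hL hr hr4 hβ => ?_⟩
  classical
  have hβ1 : β < 1 := by
    by_contra hcon
    exact DirichletCharacter.LFunction_ne_zero_of_one_le_re χ (Or.inl hχ)
      (s := β) (by simpa using not_lt.1 hcon) hL
  have h := hnear q χ hχ 0 r hr hr4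
  rw [abs_zero, zero_add] at h
  have hball : (β : ℂ) ∈ Metric.closedBall (2 + ((0 : ℝ) : ℂ) * I) (81 / 50) := by
    rw [Metric.mem_closedBall, dist_eq_norm]
    have : (β : ℂ) - (2 + ((0 : ℝ) : ℂ) * I) = ((β - 2 : ℝ) : ℂ) := by push_cast; ring
    rw [this, Complex.norm_real, Real.norm_eq_abs, abs_of_nonpos (by linarith)]
    linarith
  have hmem : (β : ℂ) ∈ DirichletDisc.discZeros χ 0 := (DirichletDisc.mem_discZeros hχ).2 ⟨hball, hL⟩
  have hfilt : (β : ℂ) ∈ (DirichletDisc.discZeros χ 0).filter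
      (fun ρ => ‖ρ - (1 + ((0 : ℝ) : ℂ) * I)‖ ≤ r) := by
    rw [Finset.mem_filter]
    refine ⟨hmem, ?_⟩
    have : (β : ℂ) - (1 + ((0 : ℝ) : ℂ) * I) = ((β - 1 : ℝ) : ℂ) := by push_cast; ring
    rw [this, Complex.norm_real, Real.norm_eq_abs, abs_of_nonpos (by linarith)]
    linarith
  have hsingle : ((DirichletDisc.discDivisor χ 0 (β : ℂ) : ℤ) : ℝ) ≤
      ∑ ρ ∈ (DirichletDisc.discZeros χ 0).filter (fun ρ => ‖ρ - (1 + ((0 : ℝ) : ℂ) * I)‖ ≤ r),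
        ((DirichletDisc.discDivisor χ 0 ρ : ℤ) : ℝ) :=
    Finset.single_le_sum (f := fun ρ => ((DirichletDisc.discDivisor χ 0 ρ : ℤ) : ℝ))
      (fun ρ _ => Int.cast_nonneg (DirichletDisc.discDivisor_nonneg hχ 0 ρ)) hfilt
  have heq : ((DirichletDisc.discDivisor χ 0 (β : ℂ) : ℤ) : ℝ) = (DirichletDisc.zeroOrder χ β : ℝ) := by
    rw [DirichletDisc.discDivisor_eq_zeroOrder hχ hball]; push_cast; rfl
  rw [← heq]
  exact hsingle.trans h

end Inputs

/-! ## Granville–Mollin (3.2) from the log-free zero-density estimate -/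

/-- `6 ≤ e²`. [folklore] -/
theorem six_le_exp_two : (6 : ℝ) ≤ Real.exp 2 := by
  have h3 : Real.exp 2 = Real.exp 1 * Real.exp 1 := by rw [← Real.exp_add]; norm_num
  rw [h3]
  nlinarith [Real.exp_one_gt_d9]

/-- **Granville–Mollin (3.2) from Bombieri's Théorème 14 for one character** (the computation of
*Le grand crible*, p. 55, in the range `x ≥ T^C`, `C > c₂`). HYPOTHESIS (a log-free zero-density
estimate with the Deuring–Heilbronn factor for one real primitive character, i.e. one term of
Bombieri's Théorème 14, with density exponent `c₂` for EVERY `c₂ > 9` — Bombieri's Remarque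
"`c₂ = 8 + ε`" (Selberg), which is what Granville–Mollin's "fixed `C > 9`" requires; Bombieri's
own proof gives an unspecified absolute `c₂`, and the Remarque is printed for the first part
only): for every `c₂ > 9` there are `c₁ > 0`, `K`, `T₀` such that for all primitive quadratic
`χ ≠ χ₀` mod `q`, all `T ≥ T₀` with `q ≤ T` and all `1/2 ≤ α ≤ 1`, (a) if `L(s, χ)` has no real zero
in `(1 − c₁/log T, 1)` ("pas de zéro exceptionnel relatif à `T, c₁`") then
`N(α, T; χ) ≤ K T^{c₂(1−α)}`, and (b) if `β₁ ∈ (1 − c₁/log T, 1)` is a real zero then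
`N(α, T; χ, β₁ excluded) ≤ K ((1 − β₁) log T) T^{c₂(1−α)}`. CONCLUSION: the named fact
`Literature.NumberTheory.LFunctions.GranvilleMollin2000_eq32`. Proof: the Landau–Page lemma of
the tree (`DirichletZFR.exists_zeroFree`, `DirichletZFR.exists_min_realZeros_le`) puts every zero
other than the Siegel zero at depth `≥ λ/log T`; `charZeroPowerSum_le_of_countT` turns the density
bound into `x^{1/2} N(T, χ) + e^{1 + c₂λ} (C/(C − c₂)) D x^{1 − λ/log T}` with `D = K` or
`K (1 − β₁) log T`; a Siegel zero relative to `q` that is not exceptional relative to `T` has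
`(1 − β₁) log T ≥ c₁`, and a mildly exceptional real zero `β₂ ≤ 1 − c/log 2q` contributes
`m(β₂) x^{β₂} ≪ x^{1 − λ/log T}` (`m(β₂) ≪ 1` by the Lemme de densité).
[cite: Bombieri1987GrandCrible, §6 Théorème 14 and pp. 54–55] [cite: GranvilleMollin2000, §3 (3.2)] -/
theorem GranvilleMollin2000_eq32_of_logFreeDensity
    (hLFD : ∀ c₂ : ℝ, 9 < c₂ → ∃ c₁ : ℝ, 0 < c₁ ∧ ∃ K T₀ : ℝ,
      ∀ (q : ℕ) [NeZero q] (χ : DirichletCharacter ℂ q), χ ≠ 1 → χ.IsPrimitive → χ.IsQuadratic →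
        ∀ T : ℝ, T₀ ≤ T → (q : ℝ) ≤ T → ∀ α : ℝ, 1 / 2 ≤ α → α ≤ 1 →
          ((∀ β : ℝ, 1 - c₁ / Real.log T < β → χ.LFunction β ≠ 0) →
              charZeroCount χ α T ∅ ≤ K * T ^ (c₂ * (1 - α))) ∧
          (∀ β₁ : ℝ, 1 - c₁ / Real.log T < β₁ → χ.LFunction β₁ = 0 →
              charZeroCount χ α T {(β₁ : ℂ)} ≤ K * ((1 - β₁) * Real.log T) * T ^ (c₂ * (1 - α)))) :
    GranvilleMollin2000_eq32 := by
  intro C hC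
  -- constants
  set c₂ : ℝ := (9 + C) / 2 with hc₂
  have hc₂9 : 9 < c₂ := by rw [hc₂]; linarith
  have hc₂C : c₂ < C := by rw [hc₂]; linarith
  have hc₂0 : 0 ≤ c₂ := by linarith
  have hCc₂ : 0 < C / (C - c₂) := div_pos (by linarith) (by linarith)
  obtain ⟨c₁, hc₁, K, T₀, hK⟩ := hLFD c₂ hc₂9
  obtain ⟨cZ, hcZ, hZ⟩ := exists_re_le_of_im_ne_zero
  obtain ⟨cU, hcU, hU⟩ := exists_realZeros_unique
  obtain ⟨Cn, hCn, hnear⟩ := exists_zeroOrder_real_le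
  obtain ⟨C₀, hC₀, hbox⟩ := exists_boxCount_le
  set lam : ℝ := min (cZ / 3) (cU / 2) with hlam
  have hlam0 : 0 < lam := lt_min (by positivity) (by positivity)
  have hlamZ : lam ≤ cZ / 3 := min_le_left _ _
  have hlamU : lam ≤ cU / 2 := min_le_right _ _
  set Kp : ℝ := max K 1 with hKp
  have hKp1 : 1 ≤ Kp := le_max_right _ _
  have hKp0 : 0 < Kp := by linarith
  have hKKp : K ≤ Kp := le_max_left _ _
  set M : ℝ := Real.exp 1 * Real.exp (c₂ * lam) * (C / (C - c₂)) * Kp with hM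
  have hM0 : 0 < M := by rw [hM]; positivity
  set K' : ℝ := C₀ + M + M * c₁ + Cn * (1 + 2 * c₁) + M / c₁ with hK'
  have hMc₁ : 0 ≤ M * c₁ := by positivity
  have hCn' : 0 ≤ Cn * (1 + 2 * c₁) := by positivity
  have hMc : 0 ≤ M / c₁ := by positivity
  have hK'C₀ : C₀ ≤ K' := by rw [hK']; linarith
  have hK'M : M ≤ K' := by rw [hK']; linarith
  have hK'B : M * c₁ + Cn * (1 + 2 * c₁) ≤ K' := by rw [hK']; linarith
  have hK'c : M / c₁ ≤ K' := by rw [hK']; linarith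
  have hK'0 : 0 < K' := by linarith
  set T₁ : ℝ := max T₀ (Real.exp (4 * c₁ + 2 * lam + 2)) with hT₁
  refine ⟨lam, hlam0, cU, hcU, K', T₁, fun q _ χ hχ hprim hquad T hT hqT x hx => ?_⟩
  -- generalities on `T`, `q`, `x`
  have hT₀T : T₀ ≤ T := (le_max_left _ _).trans hT
  have hTexp : Real.exp (4 * c₁ + 2 * lam + 2) ≤ T := (le_max_right _ _).trans hT
  have hT0 : 0 < T := lt_of_lt_of_le (Real.exp_pos _) hTexp
  have hlogT : 4 * c₁ + 2 * lam + 2 ≤ Real.log T := by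
    rw [← Real.log_exp (4 * c₁ + 2 * lam + 2)]; exact Real.log_le_log (Real.exp_pos _) hTexp
  have hT6 : 6 ≤ T := by
    have h1 : Real.exp 2 ≤ T := le_trans (Real.exp_le_exp.2 (by linarith)) hTexp
    linarith [six_le_exp_two]
  have hT1 : 1 < T := by linarith
  have hT3 : 3 ≤ T := by linarith
  have hℓ0 : 0 < Real.log T := by linarith
  have hqne1 : q ≠ 1 := fun h => hχ (DirichletCharacter.level_one' χ h)
  have hq1 : 1 < q := Nat.one_lt_iff_ne_zero_and_ne_one.2 ⟨NeZero.ne q, hqne1⟩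
  have hq2 : (2 : ℝ) ≤ q := by exact_mod_cast hq1
  have hlog2q : Real.log (2 * q) ≤ 2 * Real.log T := by
    have : (2 : ℝ) * q ≤ T * T :=
      (mul_le_mul_of_nonneg_right (by linarith) (by positivity)).trans
        (mul_le_mul_of_nonneg_left hqT hT0.le)
    calc Real.log (2 * q) ≤ Real.log (T * T) := Real.log_le_log (by positivity) this
      _ = 2 * Real.log T := by rw [Real.log_mul hT0.ne' hT0.ne']; ring
  have hlog2q0 : 0 < Real.log (2 * q) := Real.log_pos (by linarith)
  have hlogq4 : Real.log q + Real.log 4 ≤ 2 * Real.log T := by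
    have h1 : Real.log q ≤ Real.log T := Real.log_le_log (by linarith) hqT
    have h2 : Real.log 4 ≤ Real.log T := Real.log_le_log (by norm_num) (by linarith)
    linarith
  have hx1 : 1 < x := by
    have : (1 : ℝ) < T ^ C := Real.one_lt_rpow hT1 (by linarith)
    linarith
  have hx0 : 0 < x := by linarith
  -- thresholds
  have hthr : lam / Real.log T ≤ cU / Real.log (2 * q) := by
    rw [div_le_div_iff₀ hℓ0 hlog2q0]
    calc lam * Real.log (2 * q) ≤ cU / 2 * Real.log (2 * q) :=
          mul_le_mul_of_nonneg_right hlamU hlog2q0.le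
      _ ≤ cU / 2 * (2 * Real.log T) := mul_le_mul_of_nonneg_left hlog2q (by positivity)
      _ = cU * Real.log T := by ring
  have hlam2 : lam / Real.log T ≤ 1 / 2 := by
    rw [div_le_iff₀ hℓ0]; linarith
  have hc₁T : c₁ / Real.log T ≤ 1 / 4 := by
    rw [div_le_iff₀ hℓ0]; linarith
  have hlamlogT : 0 < lam / Real.log T := div_pos hlam0 hℓ0
  -- the power and the totals
  set P : ℝ := x ^ (1 / 2 : ℝ) * T ^ (3 : ℝ) with hP
  set Q : ℝ := x ^ (1 - lam / Real.log T) with hQ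
  have hP0 : 0 ≤ P := by positivity
  have hQ0 : 0 < Q := Real.rpow_pos_of_pos hx0 _
  have hN : ∑ ρ ∈ (lfunctionZeroBox_finite hχ T).toFinset, (DirichletDisc.zeroOrder χ ρ : ℝ) ≤
      C₀ * T * Real.log T :=
    hbox q χ hprim hq1 T hT6 hqT _ (fun ρ hρ => (Set.Finite.mem_toFinset _).1 hρ)
  have hNP : x ^ (1 / 2 : ℝ) * (C₀ * T * Real.log T) ≤ C₀ * P := by
    have hlogle : Real.log T ≤ T := (Real.log_le_sub_one_of_pos hT0).trans (by linarith)
    have hT3pow : T * Real.log T ≤ T ^ (3 : ℝ) := by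
      have : T ^ (3 : ℝ) = T * T * T := by
        rw [show (3 : ℝ) = ((3 : ℕ) : ℝ) by norm_num, Real.rpow_natCast]; ring
      rw [this]
      calc T * Real.log T ≤ T * T := mul_le_mul_of_nonneg_left hlogle hT0.le
        _ ≤ T * T * T := le_mul_of_one_le_right (by positivity) hT1.le
    have hx12 : 0 ≤ x ^ (1 / 2 : ℝ) := by positivity
    calc x ^ (1 / 2 : ℝ) * (C₀ * T * Real.log T) = C₀ * (x ^ (1 / 2 : ℝ) * (T * Real.log T)) := by ring
      _ ≤ C₀ * (x ^ (1 / 2 : ℝ) * T ^ (3 : ℝ)) := by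
          refine mul_le_mul_of_nonneg_left (mul_le_mul_of_nonneg_left hT3pow hx12) hC₀.le
      _ = C₀ * P := by rw [hP]
  -- the zero-free input for complex zeros
  have hreZ : ∀ ρ ∈ lfunctionZeroBox χ T, ρ.im ≠ 0 → ρ.re ≤ 1 - lam / Real.log T := by
    intro ρ hρ him
    have h := hZ q χ hχ T hT3 hqT ρ hρ him
    have : lam / Real.log T ≤ cZ / (3 * Real.log T) := by
      rw [div_le_div_iff₀ hℓ0 (by positivity)]
      have := mul_le_mul_of_nonneg_right hlamZ hℓ0.le
      linarith
    linarith
  -- a real zero in the box, as a real number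
  have hreal : ∀ ρ ∈ lfunctionZeroBox χ T, ρ.im = 0 →
      ρ = ((ρ.re : ℝ) : ℂ) ∧ χ.LFunction (ρ.re : ℂ) = 0 := by
    intro ρ hρ him
    have hρeq : ρ = ((ρ.re : ℝ) : ℂ) := Complex.ext (by simp) (by simp [him])
    refine ⟨hρeq, ?_⟩
    rw [← hρeq]; exact ((mem_lfunctionZeroBox).1 hρ).1
  -- the density hypothesis at this `T`
  have hKT := hK q χ hχ hprim hquad T hT₀T hqT
  have hTpow0 : ∀ α : ℝ, 0 ≤ T ^ (c₂ * (1 - α)) := fun α => Real.rpow_nonneg hT0.le _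
  refine ⟨fun hnoS => ?_, fun β₁ hβ₁ hLβ₁ => ?_⟩
  · /- (i): no Siegel zero relative to `q` -/
    -- real zeros are `≤ 1 − cU/log 2q ≤ 1 − λ/log T`
    have hrealS : ∀ ρ ∈ lfunctionZeroBox χ T, ρ.im = 0 → ρ.re ≤ 1 - lam / Real.log T := by
      intro ρ hρ him
      obtain ⟨-, hL⟩ := hreal ρ hρ him
      have : ρ.re ≤ 1 - cU / Real.log (2 * q) := by
        by_contra hcon; push Not at hcon; exact hnoS ρ.re hcon hL
      linarith
    by_cases hA : ∀ β : ℝ, 1 - c₁ / Real.log T < β → χ.LFunction β ≠ 0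
    · -- (A) no exceptional zero relative to `T`: density with `D = Kp`
      have hdens : ∀ α : ℝ, 1 / 2 ≤ α → α ≤ 1 - lam / Real.log T →
          charZeroCount χ α T ∅ ≤ Kp * T ^ (c₂ * (1 - α)) := fun α h1 h2 =>
        ((hKT α h1 (by linarith)).1 hA).trans (mul_le_mul_of_nonneg_right hKKp (hTpow0 α))
      have hre : ∀ ρ ∈ lfunctionZeroBox χ T, ρ ∉ (∅ : Finset ℂ) → ρ.re ≤ 1 - lam / Real.log T := by
        intro ρ hρ _
        by_cases him : ρ.im = 0
        · exact hrealS ρ hρ him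
        · exact hreZ ρ hρ him
      have key := charZeroPowerSum_le_of_countT hχ ∅ hT1 hc₂0 hc₂C hx hKp0.le hlam0 hlam2 hre
        hdens hN
      have hkey' : charZeroPowerSum χ x T ∅ ≤ C₀ * P + M * Q := by
        have : Real.exp 1 * Real.exp (c₂ * lam) * (C / (C - c₂)) * Kp *
            x ^ (1 - lam / Real.log T) = M * Q := by rw [hM, hQ]
        linarith
      calc charZeroPowerSum χ x T ∅ ≤ C₀ * P + M * Q := hkey'
        _ ≤ K' * P + K' * Q := add_le_add (mul_le_mul_of_nonneg_right hK'C₀ hP0)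
            (mul_le_mul_of_nonneg_right hK'M hQ0.le)
        _ = K' * (x ^ (1 / 2 : ℝ) * T ^ (3 : ℝ) + x ^ (1 - lam / Real.log T)) := by
            rw [hP, hQ]; ring
    · -- (B) a mildly exceptional real zero `β₂ ≤ 1 − cU/log 2q`
      push Not at hA
      obtain ⟨β₂, hβ₂, hLβ₂⟩ := hA
      have hβ₂1 : β₂ < 1 := by
        by_contra hcon
        exact DirichletCharacter.LFunction_ne_zero_of_one_le_re χ (Or.inl hχ)
          (s := β₂) (by simpa using not_lt.1 hcon) hLβ₂
      have hβ₂S : β₂ ≤ 1 - cU / Real.log (2 * q) := by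
        by_contra hcon; push Not at hcon; exact hnoS β₂ hcon hLβ₂
      have hδ : (1 - β₂) * Real.log T ≤ c₁ := by
        have : 1 - β₂ < c₁ / Real.log T := by linarith
        rw [lt_div_iff₀ hℓ0] at this; linarith
      have hδ0 : 0 ≤ (1 - β₂) * Real.log T := mul_nonneg (by linarith) hℓ0.le
      have hdens : ∀ α : ℝ, 1 / 2 ≤ α → α ≤ 1 - lam / Real.log T →
          charZeroCount χ α T {(β₂ : ℂ)} ≤ Kp * c₁ * T ^ (c₂ * (1 - α)) := by
        intro α h1 h2
        have h := (hKT α h1 (by linarith)).2 β₂ hβ₂ hLβ₂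
        calc charZeroCount χ α T {(β₂ : ℂ)} ≤ K * ((1 - β₂) * Real.log T) * T ^ (c₂ * (1 - α)) := h
          _ ≤ Kp * ((1 - β₂) * Real.log T) * T ^ (c₂ * (1 - α)) := by
              refine mul_le_mul_of_nonneg_right (mul_le_mul_of_nonneg_right hKKp hδ0) (hTpow0 α)
          _ ≤ Kp * c₁ * T ^ (c₂ * (1 - α)) := by
              refine mul_le_mul_of_nonneg_right (mul_le_mul_of_nonneg_left hδ hKp0.le) (hTpow0 α)
      have hre : ∀ ρ ∈ lfunctionZeroBox χ T, ρ ∉ ({(β₂ : ℂ)} : Finset ℂ) →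
          ρ.re ≤ 1 - lam / Real.log T := by
        intro ρ hρ _
        by_cases him : ρ.im = 0
        · exact hrealS ρ hρ him
        · exact hreZ ρ hρ him
      have key := charZeroPowerSum_le_of_countT hχ {(β₂ : ℂ)} hT1 hc₂0 hc₂C hx (by positivity)
        hlam0 hlam2 hre hdens hN
      -- the term of `β₂` itself
      have hmult : (DirichletDisc.zeroOrder χ (β₂ : ℂ) : ℝ) ≤ Cn * (1 + 2 * c₁) := by
        have h := hnear q χ hχ β₂ (c₁ / Real.log T) hLβ₂ (div_pos hc₁ hℓ0) hc₁T (by linarith)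
        refine h.trans (mul_le_mul_of_nonneg_left ?_ hCn.le)
        have : c₁ / Real.log T * (Real.log q + Real.log 4) ≤ 2 * c₁ := by
          rw [div_mul_eq_mul_div, div_le_iff₀ hℓ0]
          have := mul_le_mul_of_nonneg_left hlogq4 hc₁.le
          linarith
        linarith
      have hterm : (DirichletDisc.zeroOrder χ (β₂ : ℂ) : ℝ) * x ^ ((β₂ : ℂ)).re ≤
          Cn * (1 + 2 * c₁) * Q := by
        rw [Complex.ofReal_re, hQ]
        refine mul_le_mul hmult (Real.rpow_le_rpow_of_exponent_le hx1.le (by linarith))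
          (Real.rpow_nonneg hx0.le _) (by positivity)
      have hsplit := charZeroPowerSum_empty_le hχ hx0.le T (β₂ : ℂ)
      have hkey' : charZeroPowerSum χ x T {(β₂ : ℂ)} ≤ C₀ * P + M * c₁ * Q := by
        have : Real.exp 1 * Real.exp (c₂ * lam) * (C / (C - c₂)) * (Kp * c₁) *
            x ^ (1 - lam / Real.log T) = M * c₁ * Q := by rw [hM, hQ]; ring
        linarith
      calc charZeroPowerSum χ x T ∅ ≤ C₀ * P + (M * c₁ + Cn * (1 + 2 * c₁)) * Q := by linarith
        _ ≤ K' * P + K' * Q := add_le_add (mul_le_mul_of_nonneg_right hK'C₀ hP0)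
            (mul_le_mul_of_nonneg_right hK'B hQ0.le)
        _ = K' * (x ^ (1 / 2 : ℝ) * T ^ (3 : ℝ) + x ^ (1 - lam / Real.log T)) := by
            rw [hP, hQ]; ring
  · /- (ii): `β₁` is a Siegel zero relative to `q`; the other real zeros are below the threshold -/
    have hβ₁1 : β₁ < 1 := by
      by_contra hcon
      exact DirichletCharacter.LFunction_ne_zero_of_one_le_re χ (Or.inl hχ)
        (s := β₁) (by simpa using not_lt.1 hcon) hLβ₁
    have hre : ∀ ρ ∈ lfunctionZeroBox χ T, ρ ∉ ({(β₁ : ℂ)} : Finset ℂ) →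
        ρ.re ≤ 1 - lam / Real.log T := by
      intro ρ hρ hnot
      by_cases him : ρ.im = 0
      · obtain ⟨hρeq, hL⟩ := hreal ρ hρ him
        have hne : ρ.re ≠ β₁ := by
          intro h
          apply hnot
          rw [Finset.mem_singleton, hρeq, h]
        have : ρ.re ≤ 1 - cU / Real.log (2 * q) := by
          by_contra hcon; push Not at hcon
          exact hne (hU q χ hχ ρ.re β₁ hL hLβ₁ hcon hβ₁)
        linarith
      · exact hreZ ρ hρ him
    set δ : ℝ := (1 - β₁) * Real.log T with hδdef
    have hδ0 : 0 ≤ δ := mul_nonneg (by linarith) hℓ0.le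
    by_cases hB : 1 - c₁ / Real.log T < β₁
    · -- (a) `β₁` exceptional relative to `T`: density with `D = Kp δ`
      have hdens : ∀ α : ℝ, 1 / 2 ≤ α → α ≤ 1 - lam / Real.log T →
          charZeroCount χ α T {(β₁ : ℂ)} ≤ Kp * δ * T ^ (c₂ * (1 - α)) := by
        intro α h1 h2
        have h := (hKT α h1 (by linarith)).2 β₁ hB hLβ₁
        exact h.trans (mul_le_mul_of_nonneg_right (mul_le_mul_of_nonneg_right hKKp hδ0) (hTpow0 α))
      have key := charZeroPowerSum_le_of_countT hχ {(β₁ : ℂ)} hT1 hc₂0 hc₂C hx (by positivity)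
        hlam0 hlam2 hre hdens hN
      have hkey' : charZeroPowerSum χ x T {(β₁ : ℂ)} ≤ C₀ * P + M * δ * Q := by
        have : Real.exp 1 * Real.exp (c₂ * lam) * (C / (C - c₂)) * (Kp * δ) *
            x ^ (1 - lam / Real.log T) = M * δ * Q := by rw [hM, hQ]; ring
        linarith
      calc charZeroPowerSum χ x T {(β₁ : ℂ)} ≤ C₀ * P + M * δ * Q := hkey'
        _ ≤ K' * P + K' * δ * Q := by
            refine add_le_add (mul_le_mul_of_nonneg_right hK'C₀ hP0) ?_
            exact mul_le_mul_of_nonneg_right (mul_le_mul_of_nonneg_right hK'M hδ0) hQ0.le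
        _ = K' * (x ^ (1 / 2 : ℝ) * T ^ (3 : ℝ) +
              (1 - β₁) * Real.log T * x ^ (1 - lam / Real.log T)) := by
            rw [hP, hQ, hδdef]; ring
    · -- (b) `β₁ ≤ 1 − c₁/log T`: then `δ ≥ c₁` and no real zero is exceptional relative to `T`
      have hδc : c₁ ≤ δ := by
        have : β₁ ≤ 1 - c₁ / Real.log T := not_lt.1 hB
        have h2 : c₁ / Real.log T ≤ 1 - β₁ := by linarith
        rw [div_le_iff₀ hℓ0] at h2
        rw [hδdef]; linarith
      have hA : ∀ β : ℝ, 1 - c₁ / Real.log T < β → χ.LFunction β ≠ 0 := by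
        intro β hβ hLβ
        have hβ₁β : β₁ < β := lt_of_le_of_lt (not_lt.1 hB) hβ
        have hβS : 1 - cU / Real.log (2 * q) < β := hβ₁.trans hβ₁β
        exact hβ₁β.ne' (hU q χ hχ β β₁ hLβ hLβ₁ hβS hβ₁)
      have hdens : ∀ α : ℝ, 1 / 2 ≤ α → α ≤ 1 - lam / Real.log T →
          charZeroCount χ α T {(β₁ : ℂ)} ≤ Kp * T ^ (c₂ * (1 - α)) := by
        intro α h1 h2
        have h := (hKT α h1 (by linarith)).1 hA
        exact (charZeroCount_mono hχ α T (Finset.empty_subset _)).trans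
          (h.trans (mul_le_mul_of_nonneg_right hKKp (hTpow0 α)))
      have key := charZeroPowerSum_le_of_countT hχ {(β₁ : ℂ)} hT1 hc₂0 hc₂C hx hKp0.le
        hlam0 hlam2 hre hdens hN
      have hkey' : charZeroPowerSum χ x T {(β₁ : ℂ)} ≤ C₀ * P + M * Q := by
        have : Real.exp 1 * Real.exp (c₂ * lam) * (C / (C - c₂)) * Kp *
            x ^ (1 - lam / Real.log T) = M * Q := by rw [hM, hQ]
        linarith
      have hMQ : M * Q ≤ M / c₁ * δ * Q := by
        refine mul_le_mul_of_nonneg_right ?_ hQ0.le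
        rw [div_mul_eq_mul_div, le_div_iff₀ hc₁]
        exact mul_le_mul_of_nonneg_left hδc hM0.le
      calc charZeroPowerSum χ x T {(β₁ : ℂ)} ≤ C₀ * P + M / c₁ * δ * Q := by linarith
        _ ≤ K' * P + K' * δ * Q := by
            refine add_le_add (mul_le_mul_of_nonneg_right hK'C₀ hP0) ?_
            exact mul_le_mul_of_nonneg_right (mul_le_mul_of_nonneg_right hK'c hδ0) hQ0.le
        _ = K' * (x ^ (1 / 2 : ℝ) * T ^ (3 : ℝ) +
              (1 - β₁) * Real.log T * x ^ (1 - lam / Real.log T)) := by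
            rw [hP, hQ, hδdef]; ring

/-- **Granville–Mollin (3.3) from the log-free zero-density estimate alone.** With
Montgomery–Vaughan's Theorem 12.10 proved in the tree (`truncatedExplicitFormula_psiChar_holds`)
and (3.3) ⇐ (3.2) (`SiegelZero.GranvilleMollin2000_eq33_of_eq32`), the explicit formula in the
Linnik range `∑_{p ≤ x} (d/p) log p + x^β/β ≪ x/(|d| log x) + x^{1−c/log|d|}/η` (`x > |d|^C`,
`C > 9`) follows from the single-character log-free zero-density estimate with the
Deuring–Heilbronn factor (Bombieri's Théorème 14 for one real primitive character, exponent `c₂`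
for every `c₂ > 9`). [cite: GranvilleMollin2000, §3 (3.1)–(3.3)]
[cite: Bombieri1987GrandCrible, §6 Théorème 14 and pp. 54–55] -/
theorem GranvilleMollin2000_eq33_of_logFreeDensity
    (hLFD : ∀ c₂ : ℝ, 9 < c₂ → ∃ c₁ : ℝ, 0 < c₁ ∧ ∃ K T₀ : ℝ,
      ∀ (q : ℕ) [NeZero q] (χ : DirichletCharacter ℂ q), χ ≠ 1 → χ.IsPrimitive → χ.IsQuadratic →
        ∀ T : ℝ, T₀ ≤ T → (q : ℝ) ≤ T → ∀ α : ℝ, 1 / 2 ≤ α → α ≤ 1 →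
          ((∀ β : ℝ, 1 - c₁ / Real.log T < β → χ.LFunction β ≠ 0) →
              charZeroCount χ α T ∅ ≤ K * T ^ (c₂ * (1 - α))) ∧
          (∀ β₁ : ℝ, 1 - c₁ / Real.log T < β₁ → χ.LFunction β₁ = 0 →
              charZeroCount χ α T {(β₁ : ℂ)} ≤ K * ((1 - β₁) * Real.log T) * T ^ (c₂ * (1 - α)))) :
    SiegelZero.GranvilleMollin2000_eq33 :=
  SiegelZero.GranvilleMollin2000_eq33_of_eq32 (GranvilleMollin2000_eq32_of_logFreeDensity hLFD)

end Literature.NumberTheory.LFunctions
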